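import Mathlib
import Summits.CriticalPhenomena.PercolationContinuityZ3.Theorems.PercNearOneGluingNoHeavyLowerTailReciprocalCM
import HarnessLib

/-!
# The "good-support" lemma: `b/(h·b + (1-h)·S)` is completely monotone when `b` and `b(·+1) - h·b` are

Support file for the Sahi / Conjecture-P programme of route `PercNearOneGluingNoHeavy`
(`--supports stmt-CriticalPhenomena-4575`, prover prim-l12-p5 gen 38; proof note
`prim-l12-p5/PROOF-REGION-II-RENEWAL-g38.md` §2).  No definitions, no named facts, no sorries.

Context.  Region II of CONJECTURE A′ (memo `PROOF-ODDS-BERNSTEIN-g37.md` §4) is the statement BASE-II: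
`ρ(m) = Q_ϑ(m)/Q_{ϑ+1}(m)` is completely monotone (CM), `Q_ν = ₂F₁(-ν,-m;γ;g)`, `ϑ ∈ (0,1)`, `0 < γ < 1-ϑ`.
With `b_m := [(γ)_m/m!]·Q_ϑ(m) = [z^m](1-hz)^ϑ(1-z)^{-ϑ-γ}` and `S_m := Σ_{l ≤ m} b_l` one has
`[(γ)_m/m!]·Q_{ϑ+1}(m) = h·b_m + g·S_m` (`h = 1-g`), so `ρ = b/(h b + g S)`.  The sequence `b` is a Hausdorff moment
sequence `∫ y^m ν(dy)` with an explicit two-piece density, nonnegative exactly when `ϑ + γ ≤ 1`.  This file is the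
abstract kernel statement behind the memo's LEMMA (good support): if the representing measure of `b` is carried by
`{0} ∪ [h,1]` — in sequence language, if `m ↦ b(m+1) - h·b(m)` is CM — then `b/(h b + (1-h) S)` is CM.  The proof is
three lines on top of `…LowerTailReciprocalCM`: `c := h b + (1-h) S` is positive with CM first difference
`c(m+1) - c(m) = b(m+1) - h b(m)`, so `1/c` is CM (LEMMA DB, `altSum_inv_nonneg`), and `ρ = b · (1/c)` is CM
(Leibniz, `altSum_mul_nonneg`).  Consequences recorded in the memo: the `γ → 0⁺` limit of BASE-II (the coefficient
sequence of `((1-hz)/(1-z))^ϑ` has representing measure `h^ϑ δ_0 +` a density on `(h,1)`), and — case `h = 0`,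
`ratio_partialSum_altSum_nonneg` — for EVERY CM sequence `b` with `b 0 > 0` the ratio `b_m / Σ_{l≤m} b_l` is CM, which is
THEOREM X of g36 in discrete form throughout BASE-II (where `ν ≥ 0`), complementing `pureGrabber_x_altSum_nonneg`
(`…LowerTailOddsBernsteinX`, Region I).
-/

namespace Summit.CriticalPhenomena.PercolationContinuityZ3.Theorems

namespace MomentRatioTN

open Finset
open scoped Nat

/-- **Good-support lemma.**  Let `b : ℕ → ℝ` be completely monotone with `b 0 > 0`, let `h : ℝ`, and suppose the
sequence `m ↦ b (m+1) - h * b m` is completely monotone as well (for a Hausdorff moment sequence `b = ∫ y^m ν(dy)` this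
says `(y - h) ν(dy) ≥ 0`, i.e. `ν` is carried by `[h,1]`).  Then
`m ↦ b m / (h * b m + (1 - h) * Σ_{l ≤ m} b l)` is completely monotone. -/
theorem goodSupport_ratio_altSum_nonneg (b : ℕ → ℝ) (h : ℝ) (hb0 : 0 < b 0)
    (hb : ∀ k j, 0 ≤ ∑ i ∈ range (k + 1), (-1 : ℝ) ^ i * (k.choose i : ℝ) * b (j + i))
    (hbh : ∀ k j, 0 ≤ ∑ i ∈ range (k + 1), (-1 : ℝ) ^ i * (k.choose i : ℝ) * (b (j + i + 1) - h * b (j + i)))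
    (k j : ℕ) :
    0 ≤ ∑ i ∈ range (k + 1), (-1 : ℝ) ^ i * (k.choose i : ℝ) *
      (b (j + i) / (h * b (j + i) + (1 - h) * ∑ l ∈ range (j + i + 1), b l)) := by
  -- the denominator c and its first difference
  set c : ℕ → ℝ := fun m => h * b m + (1 - h) * ∑ l ∈ range (m + 1), b l with hc_def
  have hcΔ : ∀ m, c (m + 1) - c m = b (m + 1) - h * b m := by
    intro m
    simp only [hc_def, sum_range_succ _ (m + 1)]
    ring
  -- the first difference is nonnegative (order-0 case of `hbh`), hence c is increasing and positive
  have hstep : ∀ m, 0 ≤ b (m + 1) - h * b m := by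
    intro m
    have := hbh 0 m
    simpa using this
  have hc0 : c 0 = b 0 := by
    simp only [hc_def, zero_add, sum_range_one]
    ring
  have hcpos : ∀ m, 0 < c m := by
    intro m
    induction m with
    | zero => rw [hc0]; exact hb0
    | succ m ih => have := hcΔ m; have := hstep m; linarith
  -- CM first difference of c
  have hΔ : ∀ k j, 0 ≤ ∑ i ∈ range (k + 1), (-1 : ℝ) ^ i * (k.choose i : ℝ) * (c (j + i + 1) - c (j + i)) := by
    intro k j
    have := hbh k j
    simpa only [hcΔ] using this
  have hinv := altSum_inv_nonneg c hcpos hΔ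
  -- ρ = b · c⁻¹
  have key : ∀ m, b m / (h * b m + (1 - h) * ∑ l ∈ range (m + 1), b l) = b m * (c m)⁻¹ := by
    intro m
    rw [div_eq_mul_inv]
  simp_rw [key]
  exact altSum_mul_nonneg b (fun m => (c m)⁻¹) hb hinv k j

/-- **Case `h = 0`: the ratio to the partial sums.**  For every completely monotone sequence `b` with `b 0 > 0`,
`m ↦ b m / Σ_{l ≤ m} b l` is completely monotone.  (In the memo's notation `x_m = b_m/S_m = 1/(1 + a_m)`; for
`b_m = [(γ)_m/m!]·₂F₁(-ϑ,-m;γ;g)`, a moment sequence whenever `ϑ + γ ≤ 1`, this is THEOREM X of g36 in discrete form.) -/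
theorem ratio_partialSum_altSum_nonneg (b : ℕ → ℝ) (hb0 : 0 < b 0)
    (hb : ∀ k j, 0 ≤ ∑ i ∈ range (k + 1), (-1 : ℝ) ^ i * (k.choose i : ℝ) * b (j + i)) (k j : ℕ) :
    0 ≤ ∑ i ∈ range (k + 1), (-1 : ℝ) ^ i * (k.choose i : ℝ) * (b (j + i) / ∑ l ∈ range (j + i + 1), b l) := by
  have hbh : ∀ k j, 0 ≤ ∑ i ∈ range (k + 1), (-1 : ℝ) ^ i * (k.choose i : ℝ) *
      (b (j + i + 1) - (0 : ℝ) * b (j + i)) := by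
    intro k j
    have := hb k (j + 1)
    simp only [zero_mul, sub_zero]
    refine le_of_le_of_eq this (sum_congr rfl fun i _ => ?_)
    rw [show j + 1 + i = j + i + 1 by ring]
  have main := goodSupport_ratio_altSum_nonneg b 0 hb0 hb hbh k j
  simpa only [zero_mul, zero_add, sub_zero, one_mul] using main

end MomentRatioTN

end Summit.CriticalPhenomena.PercolationContinuityZ3.Theorems
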